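import Summits.HodgeConjecture.CorCM.Census.QuarticTwistGenerate

/-!
# The quartic twist `(ℤ/4 × B, (2,0))`, X: ORIENTED covering families — the affine reduction and the generation theorem without the
# odd-order hypothesis (the regime is prescribed by an orientation, not by uniqueness)

COR-CM (cell `pub-hodgecm2`), count-neutral kernel combinatorics by the binder seat b09 (gen 32; lane QUARTIC-TWIST), part X, a sibling of
parts III (`QuarticTwistReduction`) and VII (`QuarticTwistGenerate`) on top of part VI (`QuarticTwistClosing`).  One bookkeeping definition
(`OCovers`) + theorems; no `decide` table, no certificate, no named fact, no geometry, no `sorry`.  HONEST FRAMING: `HC_CM` is NOT proved;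
nothing here is a headline or a period.

WHY.  Parts III/VII use the UNIQUE minimising regime `reg` of a clock type, which exists only when `|B|` is odd.  For `|B|` even adjacent
regimes tie at the equator, but the proof needs much less than uniqueness: an ORIENTATION `ρ : Ty B → ℤ/4`, correct on the residual types
(`ρ (u + k·δ_b) = u`), and a covering family whose square through each non-residual `s` has `Φ`-smaller corners ALL ORIENTED LIKE `s`
(`OCovers ρ N`).  Then, verbatim as in part III, `e_s − affine (ρ s) s ∈ N` for every `s` (`single_sub_affine_mem_of_oriented`), every vector
reduces to the small residual types (`exists_reduced_of_oriented`), and — with the closing identities of part VI read in the prescribed regimes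
`ρ(𝟙_Q) = ρ(𝟙_Q − δ_i) = 0`, `ρ(𝟙_{Q+i}) = ρ(𝟙_Q + 2δ_i) = ρ(𝟙_{Q+j}) = ρ(𝟙_{Q+i+j}) = 1` — the GENERATION THEOREM
**`hodge_le_of_oriented_family`** for ANY finite group `B` with `|B| ≥ 3` and ANY `Q` with `i ≠ j ∉ Q`: a family that `ρ`-covers and contains the
column face at a constant type, the column face at `𝟙_Q` in the column `i` and the equatorial square `(𝟙_Q; (0,i), (0,j))` generates the Hodge
lattice modulo pairs.  Part XI constructs such an orientation for every `B` (ties oriented «upper»), so that `μ(ℤ/4 × B) ≤ β − 1` for every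
finite group `B` of order `≥ 3` (part XII); for `|B|` odd, `ρ = reg` recovers part VII.  All [folklore].

## References
* [Pohlmann1968] H. Pohlmann, Algebraic cycles on abelian varieties of complex multiplication type, Ann. of Math. 88 (1968), Thm 1.
-/

namespace Summit.HodgeConjecture.CorCM.Census.QuarticTwist

open Finset

variable (B : Type) [AddGroup B] [Fintype B] [DecidableEq B]

/-! ## §1 Oriented covering families and the affine reduction -/

/-- **An oriented covering family.**  Through every non-residual type `s` the submodule `N` contains the class of a cross square whose three
other corners have smaller Lee potential and the SAME orientation `ρ` as `s`. [folklore] -/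
def OCovers (ρ : Ty B → ZMod 4) (N : Submodule ℤ (Ty B → ℤ)) : Prop :=
  ∀ s : Ty B, ¬ IsRes B s → ∃ p q : ZMod 2 × B, p.2 ≠ q.2 ∧ faceVec B s p q ∈ N ∧
    (Phi B (flip B p s) < Phi B s ∧ ρ (flip B p s) = ρ s) ∧ (Phi B (flip B q s) < Phi B s ∧ ρ (flip B q s) = ρ s) ∧
    (Phi B (flip B q (flip B p s)) < Phi B s ∧ ρ (flip B q (flip B p s)) = ρ s)

omit [AddGroup B] in
/-- **THE ORIENTED AFFINE REDUCTION.**  If `ρ` is correct on the residual types and `N` `ρ`-covers, then `e_s − affine (ρ s) s ∈ N` for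
every type `s`. [folklore] -/
theorem single_sub_affine_mem_of_oriented {ρ : Ty B → ZMod 4} (hρ : ∀ (u : ZMod 4) (b : B) (k : ZMod 4), ρ (atom B u b k) = u)
    {N : Submodule ℤ (Ty B → ℤ)} (hN : OCovers B ρ N) (s : Ty B) : Pi.single s 1 - affine B (ρ s) s ∈ N := by
  induction hΦ : Phi B s using Nat.strong_induction_on generalizing s with
  | _ n ih =>
  by_cases hres : IsRes B s
  · obtain ⟨u, b, k, rfl⟩ := hres
    rw [hρ, affine_atom, sub_self]
    exact Submodule.zero_mem _
  · obtain ⟨p, q, hpq, hface, ⟨h1, r1⟩, ⟨h2, r2⟩, ⟨h12, r12⟩⟩ := hN s hres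
    obtain ⟨u, hu⟩ : ∃ u, ρ s = u := ⟨_, rfl⟩
    obtain ⟨e₁, he₁⟩ : ∃ e₁, step p.1 (s p.2) = e₁ := ⟨_, rfl⟩
    obtain ⟨e₂, he₂⟩ : ∃ e₂, step q.1 (s q.2) = e₂ := ⟨_, rfl⟩
    have hs₁ : flip B p s = s + Pi.single p.2 e₁ := by rw [flip_eq_add_single, he₁]
    have hs₂ : flip B q s = s + Pi.single q.2 e₂ := by rw [flip_eq_add_single, he₂]
    have hs₁₂ : flip B q (flip B p s) = s + Pi.single p.2 e₁ + Pi.single q.2 e₂ := by rw [flip_flip_of_ne B p q hpq s, he₁, he₂]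
    rw [hu] at r1 r2 r12
    have i₁ := ih _ (h1.trans_eq hΦ) (flip B p s) rfl
    have i₂ := ih _ (h2.trans_eq hΦ) (flip B q s) rfl
    have i₁₂ := ih _ (h12.trans_eq hΦ) (flip B q (flip B p s)) rfl
    rw [r1] at i₁
    rw [r2] at i₂
    rw [r12] at i₁₂
    have hadd := affine_square B u s hpq e₁ e₂
    rw [← hs₁₂, ← hs₁, ← hs₂] at hadd
    rw [hu]
    have key : Pi.single s 1 - affine B u s = faceVec B s p q + (Pi.single (flip B p s) 1 - affine B u (flip B p s))
        + (Pi.single (flip B q s) 1 - affine B u (flip B q s))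
        - (Pi.single (flip B q (flip B p s)) 1 - affine B u (flip B q (flip B p s)))
        - (affine B u s - affine B u (flip B p s) - affine B u (flip B q s) + affine B u (flip B q (flip B p s))) := by
      unfold faceVec; abel
    rw [key, hadd, sub_zero]
    exact Submodule.sub_mem _ (Submodule.add_mem _ (Submodule.add_mem _ hface i₁) i₂) i₁₂

omit [AddGroup B] in
/-- **Reduction to the small residual types, oriented form.** [folklore] -/
theorem exists_reduced_of_oriented (h3 : 3 ≤ Fintype.card B) {ρ : Ty B → ZMod 4} (hρ : ∀ (u : ZMod 4) (b : B) (k : ZMod 4), ρ (atom B u b k) = u)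
    {N : Submodule ℤ (Ty B → ℤ)} (hN : OCovers B ρ N) (hC : HasColumnFaces B N) (m : Ty B → ℤ) :
    ∃ r : Ty B → ℤ, m - r ∈ N ∧ ∀ t, r t ≠ 0 → IsRes1 B t := by
  suffices h : m ∈ Good B N from h
  have hm : m = ∑ s, m s • Pi.single s (1 : ℤ) := by
    conv_lhs => rw [← Finset.univ_sum_single m]
    refine Finset.sum_congr rfl ?_
    intro s _
    funext t
    rw [Pi.smul_apply, Pi.single_apply, Pi.single_apply, smul_eq_mul]
    split_ifs <;> simp
  rw [hm]
  refine Submodule.sum_mem _ fun s _ => Submodule.smul_mem _ _ ?_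
  have e : Pi.single s (1 : ℤ) = (Pi.single s 1 - affine B (ρ s) s) + affine B (ρ s) s := by abel
  rw [e]
  have hne : Nonempty B := Fintype.card_pos_iff.mp (by omega)
  exact Submodule.add_mem _ (le_good B N (single_sub_affine_mem_of_oriented B hρ hN s)) (affine_mem_good B hC hne.some _ s)

/-! ## §2 The generation theorem for an oriented family -/

/-- **THE GENERATION THEOREM, ORIENTED FORM** (`|B| ≥ 3`, any parity).  Let `ρ` be an orientation correct on the residual types and `S` a
family of faces such that `pairs ⊔ spanFaces S` `ρ`-covers, containing a column face at a constant type, the column face at `𝟙_Q` in a column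
`i ∉ Q` and the equatorial square `(𝟙_Q; (0,i), (0,j))` (`j ∉ Q`, `j ≠ i`), where the six corner types are oriented
`ρ(𝟙_Q) = ρ(𝟙_Q − δ_i) = 0` and `ρ(𝟙_{Q+i}) = ρ(𝟙_Q + 2δ_i) = ρ(𝟙_{Q+j}) = ρ(𝟙_{Q+i+j}) = 1`.  Then `hodge B ≤ pairs B ⊔ spanFaces B S`. [folklore] -/
theorem hodge_le_of_oriented_family (h3 : 3 ≤ Fintype.card B) {ρ : Ty B → ZMod 4}
    (hρ : ∀ (u : ZMod 4) (b : B) (k : ZMod 4), ρ (atom B u b k) = u)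
    {S : Finset (Ty B × (ZMod 2 × B) × (ZMod 2 × B))} (hS : ∀ f ∈ S, f.2.1 ≠ f.2.2) (hcov : OCovers B ρ (pairs B ⊔ spanFaces B S))
    {b₀ : B} (hcol : (cst B 0, ((0 : ZMod 2), b₀), ((1 : ZMod 2), b₀)) ∈ S)
    {Q : Finset B} {i j : B} (hi : i ∉ Q) (hj : j ∉ Q) (hji : j ≠ i)
    (r0 : ρ (prof B Q i 0) = 0) (r1 : ρ (prof B Q i 1) = 1) (rm1 : ρ (prof B Q i (-1)) = 0) (r2 : ρ (prof B Q i 2) = 1)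
    (rj0 : ρ (prof B (insert j Q) i 0) = 1) (rj1 : ρ (prof B (insert j Q) i 1) = 1)
    (hF2 : (prof B Q i 0, ((0 : ZMod 2), i), ((1 : ZMod 2), i)) ∈ S) (hF3 : (prof B Q i 0, ((0 : ZMod 2), i), ((0 : ZMod 2), j)) ∈ S) :
    hodge B ≤ pairs B ⊔ spanFaces B S := by
  have hNH : pairs B ⊔ spanFaces B S ≤ hodge B := sup_le (pairs_le_hodge B) (spanFaces_le_hodge B hS)
  have hNt : ∀ v ∈ pairs B ⊔ spanFaces B S, ∀ g : ZMod 4 × B, transl B g v ∈ pairs B ⊔ spanFaces B S :=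
    fun v hv g => transl_mem_sup B hv g
  have hC : HasColumnFaces B (pairs B ⊔ spanFaces B S) := hasColumnFaces_of_mem B hcol
  have hP : pairs B ≤ pairs B ⊔ spanFaces B S := le_sup_left
  obtain ⟨N, hN⟩ : ∃ N : Submodule ℤ (Ty B → ℤ), pairs B ⊔ spanFaces B S = N := ⟨_, rfl⟩
  rw [hN] at hNH hNt hC hP hcov ⊢
  obtain ⟨c1, c2, c12, cj, cij⟩ := corners B Q hi hj hji
  have red : ∀ s : Ty B, Pi.single s 1 - affine B (ρ s) s ∈ N := fun s => single_sub_affine_mem_of_oriented B hρ hcov s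
  have eT1 := red (prof B Q i 0); rw [r0] at eT1
  have eC1 := red (prof B Q i 1); rw [r1] at eC1
  have eCm := red (prof B Q i (-1)); rw [rm1] at eCm
  have eC2 := red (prof B Q i 2); rw [r2] at eC2
  have eCj := red (prof B (insert j Q) i 0); rw [rj0] at eCj
  have eCij := red (prof B (insert j Q) i 1); rw [rj1] at eCij
  -- (1) `X_{1,i} ∈ N`
  have hF2N : faceVec B (prof B Q i 0) (0, i) (1, i) ∈ N := by
    have h := faceVec_mem_spanFaces B hF2
    rw [← hN]
    exact Submodule.mem_sup_right h
  have hX1 : Xvec B 1 i ∈ N := by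
    have hcl := closing_column B Q hi
    have e : Xvec B 1 i = faceVec B (prof B Q i 0) (0, i) (1, i)
        - (((Pi.single (prof B Q i 0) (1 : ℤ) : Ty B → ℤ) - affine B 0 (prof B Q i 0))
          - ((Pi.single (prof B Q i 1) (1 : ℤ) : Ty B → ℤ) - affine B 1 (prof B Q i 1))
          - ((Pi.single (prof B Q i (-1)) (1 : ℤ) : Ty B → ℤ) - affine B 0 (prof B Q i (-1)))
          + ((Pi.single (prof B Q i 2) (1 : ℤ) : Ty B → ℤ) - affine B 1 (prof B Q i 2)))
        - pairVec B (cst B 0) + pairVec B (atom B 0 i (-1)) := by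
      have e' : faceVec B (prof B Q i 0) (0, i) (1, i)
          - (((Pi.single (prof B Q i 0) (1 : ℤ) : Ty B → ℤ) - affine B 0 (prof B Q i 0))
            - ((Pi.single (prof B Q i 1) (1 : ℤ) : Ty B → ℤ) - affine B 1 (prof B Q i 1))
            - ((Pi.single (prof B Q i (-1)) (1 : ℤ) : Ty B → ℤ) - affine B 0 (prof B Q i (-1)))
            + ((Pi.single (prof B Q i 2) (1 : ℤ) : Ty B → ℤ) - affine B 1 (prof B Q i 2)))
          = affine B 0 (prof B Q i 0) - affine B 1 (prof B Q i 1) - affine B 0 (prof B Q i (-1)) + affine B 1 (prof B Q i 2) := by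
        unfold faceVec; rw [c12, c1, c2]; abel
      rw [e', hcl]; abel
    rw [e]
    refine Submodule.add_mem _ (Submodule.sub_mem _ (Submodule.sub_mem _ hF2N ?_) (hP (pairVec_mem_pairs B _))) (hP (pairVec_mem_pairs B _))
    exact Submodule.add_mem _ (Submodule.sub_mem _ (Submodule.sub_mem _ eT1 eC1) eCm) eC2
  have hX : ∀ (u : ZMod 4) (b : B), Xvec B u b ∈ N := Xvec_mem_of_one B hNt hX1
  -- (2) `w_1 ∈ N`
  have hF3N : faceVec B (prof B Q i 0) (0, i) (0, j) ∈ N := by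
    have h := faceVec_mem_spanFaces B hF3
    rw [← hN]
    exact Submodule.mem_sup_right h
  have hW1 : Wvec B 1 ∈ N := by
    have hcl := closing_square B Q hi hj hji
    have e : Wvec B 1 = (∑ q ∈ Q, Xvec B 0 q) - (faceVec B (prof B Q i 0) (0, i) (0, j)
        - (((Pi.single (prof B Q i 0) (1 : ℤ) : Ty B → ℤ) - affine B 0 (prof B Q i 0))
          - ((Pi.single (prof B Q i 1) (1 : ℤ) : Ty B → ℤ) - affine B 1 (prof B Q i 1))
          - ((Pi.single (prof B (insert j Q) i 0) (1 : ℤ) : Ty B → ℤ) - affine B 1 (prof B (insert j Q) i 0))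
          + ((Pi.single (prof B (insert j Q) i 1) (1 : ℤ) : Ty B → ℤ) - affine B 1 (prof B (insert j Q) i 1)))) := by
      have e' : faceVec B (prof B Q i 0) (0, i) (0, j)
          - (((Pi.single (prof B Q i 0) (1 : ℤ) : Ty B → ℤ) - affine B 0 (prof B Q i 0))
            - ((Pi.single (prof B Q i 1) (1 : ℤ) : Ty B → ℤ) - affine B 1 (prof B Q i 1))
            - ((Pi.single (prof B (insert j Q) i 0) (1 : ℤ) : Ty B → ℤ) - affine B 1 (prof B (insert j Q) i 0))
            + ((Pi.single (prof B (insert j Q) i 1) (1 : ℤ) : Ty B → ℤ) - affine B 1 (prof B (insert j Q) i 1)))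
          = affine B 0 (prof B Q i 0) - affine B 1 (prof B Q i 1) - affine B 1 (prof B (insert j Q) i 0)
            + affine B 1 (prof B (insert j Q) i 1) := by
        unfold faceVec; rw [cij, c1, cj]; abel
      rw [e', hcl]; abel
    rw [e]
    refine Submodule.sub_mem _ (Submodule.sum_mem _ fun q _ => hX 0 q) (Submodule.sub_mem _ hF3N ?_)
    exact Submodule.add_mem _ (Submodule.sub_mem _ (Submodule.sub_mem _ eT1 eC1) eCj) eCij
  have hW : ∀ u : ZMod 4, Wvec B u ∈ N := Wvec_mem_of_one B hNt hW1
  -- (3) reduce and absorb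
  intro v hv
  obtain ⟨r, hr, hsupp⟩ := exists_reduced_of_oriented B h3 hρ hcov hC v
  have hrH : r ∈ hodge B := by
    have e : r = v - (v - r) := by abel
    rw [e]
    exact Submodule.sub_mem _ hv (hNH hr)
  have hrN : r ∈ N := residual_mem B h3 hP hX hW hrH hsupp
  have e : v = (v - r) + r := by abel
  rw [e]
  exact Submodule.add_mem _ hr hrN

end Summit.HodgeConjecture.CorCM.Census.QuarticTwist
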